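import Literature.NumberTheory.EllipticCurves.TwoPowerTorsion
import Summits.BirchSwinnertonDyer.BirchSwinnertonDyer.Theorems.PrintCf2SplitBadTwoCMPrimaryDecompositionAtTwo
import Summits.BirchSwinnertonDyer.BirchSwinnertonDyer.Theorems.PrintCf2SplitBadTwoCMComplementStructure
import HarnessLib

/-!
# Crux `PrintCf2.SplitBadTwoRankOneOfFacts` (item stmt-BirchSwinnertonDyer-20368), road α over the CM field:
# STRUCTURE of the CM summands `E[𝔭^∞]`, `E[𝔭̄^∞]` — `2`-divisible, `#E[𝔭^k] = 2^k` cyclic (`ℤ₂`-corank ONE), and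
# `Γ_L` acts on each by a CHARACTER (an integer scalar at every level)

Cell `bsd-print-cf2`, width seat `bsd-line-cf2-p1-w2` g7; `--supports stmt-BirchSwinnertonDyer-20368` (helper); sequel of p643651 /
p643722 / p644268 (`…CMEigenDecomposition`, `…CMEndomorphismSqrtMinusSeven`, `…CMPrimaryDecompositionAtTwo`). HONEST FRAMING: nothing
here closes a crux or a stub; BSD is not proved by any of this; no summit statement is proved by this seat.

WHY. Road α's Iwasawa-theoretic research statements (planner RULING (ab): S3b twist-and-push at the `λ`-branch, S3c restricted-Selmer
control on `W[𝔭̄₀^∞]`) treat the `𝔮`-primary summand of a CM curve as a `GL₁` object: `E[𝔮^∞] ≅ K_𝔮/𝓞_𝔮 ≅ ℚ₂/ℤ₂` with `Γ_K`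
acting through the CM character `ψ_𝔮 : Γ_K → ℤ₂^×` (Rubin, LNM 1716, §2, Prop. 5.4; Coates 1983 §2). This file proves exactly that
shape, in kernel currency and without new definitions, for the summands delivered by `CMPrimes.exists_cmPrimaryDecomposition_two`:

* §1 = companion file `…CMComplementStructure` (p645011; generic, any prime `p`): complementary subgroups of a `p`-primary,
  `p`-DIVISIBLE group with `#M[p] = p²` are `p`-divisible with `#Cᵢ[p^k] = p^k` cyclic, and summand-preserving maps are integer scalars.
* §2 `two_dvd_or_two_dvd_one_sub_of_root` (a root `r` of `X² − X + 2` in `ℤ₂`: `2 ∣ r` or `2 ∣ 1 − r`, and `2r − 1 ∈ ℤ₂^×` as its square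
  is `−7`), `exists_eigen_pair_two` / `cmPrimary_compl_two` (the ∀-`π`, ∀-`r` form of the decomposition: the eigen-subgroups of
  `(π, r)` and `(π, 1 − r)` are complementary, non-zero, `Γ_L`-stable) and **`cmPrimary_structure_two`** — `W/ℚ` elliptic, `j = −3375`, `L` a number field with `θ² = −7`, `π ∈ End_{L̄}(E_L)` with
  `π² = π − 2`, `r` ANY `2`-adic root, `C ≤ E_L[2^∞]` the subgroup where `π` acts as `r` (so `C = E[𝔭^∞]` or `E[𝔭̄^∞]`): `C` is
  `Γ_L`-stable, non-zero, `2`-divisible, `#C[2^k] = 2^k` with `C[2^k] = ℤ·g_k` cyclic, and every `σ ∈ Γ_L` acts on `C[2^k]` as an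
  integer scalar. Inputs: the three companion files, `#E[2] = 4` (`card_geomTorsion_two_pow`), `2·E(L̄) = E(L̄)`
  (`two_nsmul_surjective_of_isAlgClosed`).
NOT here: the `2`-adic character `ψ_𝔮 : Γ_L → ℤ₂^×` as a single continuous homomorphism (the scalars `N_k(σ)` are produced level by
level; their `2`-adic limit is not packaged), the identification of `C` with Greenberg's local line at a place `v ∣ 2`, the
complex-conjugation swap `E[𝔭^∞] ↔ E[𝔭̄^∞]`.

References: K. Rubin, *Elliptic curves with complex multiplication and the conjecture of Birch and Swinnerton-Dyer*, LNM 1716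
(1999), §2 and Prop. 5.4; J. Coates, *Infinite descent on elliptic curves with complex multiplication* (1983) §2;
[SilvermanATAEC1994] II §1 Prop. 1.1, II §2 Thm. 2.2(b), App. A §3; [SilvermanAEC2009] III.§7, Exercise 3.31.
-/

noncomputable section

open scoped Classical

set_option linter.dupNamespace false
set_option autoImplicit false

namespace Summit.BirchSwinnertonDyer.BirchSwinnertonDyer.Theorems.PrintCf2.CMPrimes

/-! ## §2 The curve: structure of the CM summands `E[𝔭^∞]`, `E[𝔭̄^∞]` of `E_L[2^∞]` (`j = −3375`, `L ∋ √−7`) -/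

section Curve

open WeierstrassCurve Literature.NumberTheory.EllipticCurves Field

/-- `‖r‖·‖1 − r‖`-dichotomy for a root of `X² − X + 2` in `ℤ₂`: `2 ∣ r` or `2 ∣ 1 − r` (as `r(1 − r) = 2`), and
`r − (1 − r) = 2r − 1` is a unit (its square is `−7`). [folklore] -/
theorem two_dvd_or_two_dvd_one_sub_of_root {r : ℤ_[2]} (hr : r * r = r - 2) :
    ((2 : ℤ_[2]) ∣ r ∨ (2 : ℤ_[2]) ∣ (1 - r)) ∧ IsUnit (r - (1 - r)) := by
  haveI : Fact (Nat.Prime 2) := ⟨Nat.prime_two⟩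
  constructor
  · have h2 : r * (1 - r) = 2 := by linear_combination -hr
    have hdvd : (2 : ℤ_[2]) ∣ r * (1 - r) := ⟨1, by rw [h2, mul_one]⟩
    have hp : Prime ((2 : ℕ) : ℤ_[2]) := PadicInt.prime_p
    exact hp.dvd_or_dvd (by exact_mod_cast hdvd)
  · have hsq : (r - (1 - r)) * (r - (1 - r)) = ((-7 : ℤ) : ℤ_[2]) := by
      push_cast; linear_combination 4 * hr
    have h7 : IsUnit (((-7 : ℤ) : ℤ_[2])) := by
      rw [PadicInt.isUnit_iff]
      refine le_antisymm (PadicInt.norm_le_one _) (not_lt.mp fun hlt ↦ ?_)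
      have := (PadicInt.norm_int_lt_one_iff_dvd (p := 2) (-7)).mp hlt
      omega
    rw [← hsq] at h7
    exact isUnit_of_mul_isUnit_left h7

/-- **The eigen-pair of `(π, r)` on `E_L[2^∞]`** (`j = −3375`, `L ∋ √−7`, `π² = π − 2`, `r` ANY root of `X² − X + 2`): subgroups
`C₁` (π acts as `r`) and `C₂` (π acts as `1 − r`) with `C₁ ⊓ C₂ = ⊥`, `C₁ ⊔ C₂ = ⊤`, both `≠ ⊥` (`ker π`, `ker (1 − π)` are non-zero
`2`-torsion and each lies in one of them), both `Γ_L`-stable. (The ∀-`π`, ∀-`r` form of `exists_cmPrimaryDecomposition_two`.)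
[cite: SilvermanATAEC1994, II §1 Prop. 1.1, II §2 Thm. 2.2(b), App. A §3 (row D = -7)] -/
theorem exists_eigen_pair_two (W : WeierstrassCurve ℚ) [W.IsElliptic] (hj : W.j = -3375)
    (L : Type) [Field L] [NumberField L] {θ : L} (hθ : θ ^ 2 = -7)
    {π : AddMonoid.End (W.baseChange L).geomPoints} (hπ : π ∈ (W.baseChange L).geomEndRing) (hrel : π * π = π - 2)
    {r : ℤ_[2]} (hr : r * r = r - 2) :
    ∃ C₁ C₂ : AddSubgroup ((W.baseChange L).geomPrimaryTorsion 2),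
      (∀ x, x ∈ C₁ ↔ ∀ (k : ℕ) (N : ℤ), 2 ^ k • x = 0 →
        ((N : ℤ_[2]) - r) ∈ (Ideal.span {(2 : ℤ_[2]) ^ k} : Ideal ℤ_[2]) →
          π (x : (W.baseChange L).geomPoints) = N • (x : (W.baseChange L).geomPoints)) ∧
      (∀ x, x ∈ C₂ ↔ ∀ (k : ℕ) (N : ℤ), 2 ^ k • x = 0 →
        ((N : ℤ_[2]) - (1 - r)) ∈ (Ideal.span {(2 : ℤ_[2]) ^ k} : Ideal ℤ_[2]) →
          π (x : (W.baseChange L).geomPoints) = N • (x : (W.baseChange L).geomPoints)) ∧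
      C₁ ⊓ C₂ = ⊥ ∧ C₁ ⊔ C₂ = ⊤ ∧ C₁ ≠ ⊥ ∧ C₂ ≠ ⊥ ∧
      (∀ σ : absoluteGaloisGroup L, (∀ x ∈ C₁, σ • x ∈ C₁) ∧ (∀ x ∈ C₂, σ • x ∈ C₂)) := by
  haveI : Fact (Nat.Prime 2) := ⟨Nat.prime_two⟩
  have hjV : (W.baseChange L).j = -3375 := by simp only [baseChange, map_j, hj]; norm_num
  obtain ⟨-, hequiv⟩ := cmEndo_mem_endRing_of_sq_eq_neg_seven (W.baseChange L) hjV hθ hπ hrel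
  obtain ⟨hdich, hunit⟩ := two_dvd_or_two_dvd_one_sub_of_root hr
  -- the module `M = E_L[2^∞]`, the restriction `πM` of `π`
  set M := ↥((W.baseChange L).geomPrimaryTorsion 2) with hM_def
  have hmem : ∀ x : M, π (x : (W.baseChange L).geomPoints) ∈ (W.baseChange L).geomPrimaryTorsion 2 := fun x ↦ by
    obtain ⟨k, hk⟩ := (AddCommGroup.mem_primaryComponent).mp x.2
    exact (AddCommGroup.mem_primaryComponent).mpr ⟨k, by rw [← map_nsmul, hk, map_zero]⟩
  let πM : M →+ M :=
    { toFun := fun x ↦ ⟨π (x : (W.baseChange L).geomPoints), hmem x⟩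
      map_zero' := Subtype.ext (by simp)
      map_add' := fun x y ↦ Subtype.ext (by
        change π ((x : (W.baseChange L).geomPoints) + y) = π x + π y
        rw [map_add]) }
  have hπM : ∀ x : M, ((πM x : M) : (W.baseChange L).geomPoints) = π (x : (W.baseChange L).geomPoints) := fun _ ↦ rfl
  have hMp : ∀ x : M, ∃ k : ℕ, 2 ^ k • x = 0 := fun x ↦ by
    obtain ⟨k, hk⟩ := (AddCommGroup.mem_primaryComponent).mp x.2
    exact ⟨k, Subtype.ext (by rw [AddSubmonoidClass.coe_nsmul, ZeroMemClass.coe_zero]; exact hk)⟩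
  have hπMrel : ∀ x : M, πM (πM x) = (1 : ℤ) • πM x - (2 : ℤ) • x := fun x ↦
    Subtype.ext (by
      rw [AddSubgroupClass.coe_sub, AddSubgroupClass.coe_zsmul, AddSubgroupClass.coe_zsmul, hπM, hπM, one_zsmul,
        cmEndo_apply_apply (W.baseChange L) hrel]
      norm_cast)
  have hsum' : r + (1 - r) = ((1 : ℤ) : ℤ_[2]) := by push_cast; ring
  have hprod' : r * (1 - r) = ((2 : ℤ) : ℤ_[2]) := by push_cast; linear_combination -hr
  obtain ⟨C₁, C₂, hC₁, hC₂, hinf, hsup, hstab, -⟩ :=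
    exists_eigenDecomposition (p := 2) hMp πM hπMrel hsum' hprod' hunit
  -- translate memberships
  have htr : ∀ (ρ : ℤ_[2]) (x : M),
      (∀ (k : ℕ) (N : ℤ), 2 ^ k • x = 0 →
        ((N : ℤ_[2]) - ρ) ∈ (Ideal.span {(2 : ℤ_[2]) ^ k} : Ideal ℤ_[2]) → πM x = N • x) ↔
      (∀ (k : ℕ) (N : ℤ), 2 ^ k • x = 0 →
        ((N : ℤ_[2]) - ρ) ∈ (Ideal.span {(2 : ℤ_[2]) ^ k} : Ideal ℤ_[2]) →
          π (x : (W.baseChange L).geomPoints) = N • (x : (W.baseChange L).geomPoints)) := fun ρ x ↦ by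
    refine forall_congr' fun k ↦ forall_congr' fun N ↦ forall_congr' fun _ ↦ forall_congr' fun _ ↦ ?_
    rw [Subtype.ext_iff, hπM, AddSubgroupClass.coe_zsmul]
  -- Galois stability (every `σ` commutes with `π`)
  have hGal : ∀ σ : absoluteGaloisGroup L, (∀ x ∈ C₁, σ • x ∈ C₁) ∧ (∀ x ∈ C₂, σ • x ∈ C₂) := fun σ ↦
    hstab (DistribMulAction.toAddMonoidEnd (absoluteGaloisGroup L) M σ) fun x ↦
      Subtype.ext (by
        change σ • π (x : (W.baseChange L).geomPoints) = π (σ • (x : (W.baseChange L).geomPoints))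
        rw [hequiv])
  -- `#ker π = #ker (1 − π) = 2` for the given `π` (it is `π₀` or `1 − π₀` for the base-changed `π₀`)
  obtain ⟨hker, hker'⟩ :
      Nat.card (π : (W.baseChange L).geomPoints →+ (W.baseChange L).geomPoints).ker = 2 ∧
      Nat.card ((1 - π : AddMonoid.End (W.baseChange L).geomPoints) :
        (W.baseChange L).geomPoints →+ (W.baseChange L).geomPoints).ker = 2 := by
    obtain ⟨π₀, hπ₀, hrel₀, hk₀, hk₀'⟩ := exists_cmEndo_baseChange W hj L
    haveI := isDomain_geomEndRing (W.baseChange L)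
    letI : CommRing (W.baseChange L).geomEndRing :=
      { (inferInstance : Ring (W.baseChange L).geomEndRing) with
        mul_comm := fun x y ↦ Subtype.ext ((W.baseChange L).geomEndRing_comm_holds _ _ x.2 y.2) }
    set x : (W.baseChange L).geomEndRing := ⟨π, hπ⟩
    set y : (W.baseChange L).geomEndRing := ⟨π₀, hπ₀⟩
    have hx : x * x = x - 2 := Subtype.ext (by push_cast; exact hrel)
    have hy : y * y = y - 2 := Subtype.ext (by push_cast; exact hrel₀)
    have hxy : (x - y) * (x - (1 - y)) = 0 := by linear_combination hx - hy
    rcases mul_eq_zero.mp hxy with h | h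
    · have : π = π₀ := congrArg Subtype.val (sub_eq_zero.mp h)
      subst this; exact ⟨hk₀, hk₀'⟩
    · have h1 : π = 1 - π₀ := by simpa using congrArg Subtype.val (sub_eq_zero.mp h)
      have h2 : (1 - π : AddMonoid.End (W.baseChange L).geomPoints) = π₀ := by rw [h1, sub_sub_cancel]
      refine ⟨?_, ?_⟩
      · rw [h1]; exact hk₀'
      · rw [h2]; exact hk₀
  have h1π : ∀ P, (1 - π : AddMonoid.End (W.baseChange L).geomPoints) P = P - π P := fun P ↦ by
    change ((1 : AddMonoid.End (W.baseChange L).geomPoints) : _ →+ _) P - (π : _ →+ _) P = _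
    simp
  -- a non-zero `P` with `π P = c • P`, `2P = 0` lies in the summand whose root is `≡ c (mod 2)`
  have hplace : ∀ (ρ : ℤ_[2]) (c : ℤ) (D : AddSubgroup M),
      (∀ x, x ∈ D ↔ ∀ (k : ℕ) (N : ℤ), 2 ^ k • x = 0 →
        ((N : ℤ_[2]) - ρ) ∈ (Ideal.span {(2 : ℤ_[2]) ^ k} : Ideal ℤ_[2]) → πM x = N • x) →
      ((c : ℤ_[2]) - ρ) ∈ (Ideal.span {(2 : ℤ_[2]) ^ 1} : Ideal ℤ_[2]) →
      (∃ P : (W.baseChange L).geomPoints, π P = c • P ∧ P ≠ 0 ∧ 2 • P = 0) → D ≠ ⊥ := by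
    intro ρ c D hD hc ⟨P, hP, hP0, h2P⟩ hbot
    have hPM : P ∈ (W.baseChange L).geomPrimaryTorsion 2 :=
      (AddCommGroup.mem_primaryComponent).mpr ⟨1, by rw [pow_one, h2P]⟩
    have hx : (⟨P, hPM⟩ : M) ∈ D := by
      rw [hD]
      refine eigen_of_level πM ρ (k := 1) (N₁ := c)
        (Subtype.ext (by rw [AddSubmonoidClass.coe_nsmul, ZeroMemClass.coe_zero, pow_one]; exact h2P)) hc (Subtype.ext ?_)
      rw [hπM, AddSubgroupClass.coe_zsmul]; exact hP
    rw [hbot, AddSubgroup.mem_bot] at hx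
    exact hP0 (congrArg Subtype.val hx)
  have hkerP : ∃ P : (W.baseChange L).geomPoints, π P = (0 : ℤ) • P ∧ P ≠ 0 ∧ 2 • P = 0 := by
    obtain ⟨P, hP, hP0⟩ : ∃ P : (W.baseChange L).geomPoints, π P = 0 ∧ P ≠ 0 := by
      by_contra hno
      push Not at hno
      have : (π : (W.baseChange L).geomPoints →+ (W.baseChange L).geomPoints).ker = ⊥ := by
        rw [eq_bot_iff]; intro P hPk; exact (AddSubgroup.mem_bot).mpr (hno P hPk)
      rw [this, AddSubgroup.card_bot] at hker
      exact absurd hker (by norm_num)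
    refine ⟨P, by rw [zero_zsmul]; exact hP, hP0, ?_⟩
    have h := cmEndo_apply_apply (W.baseChange L) hrel P
    rw [hP, map_zero, zero_sub, eq_comm, neg_eq_zero] at h
    exact h
  have hker1P : ∃ P : (W.baseChange L).geomPoints, π P = (1 : ℤ) • P ∧ P ≠ 0 ∧ 2 • P = 0 := by
    obtain ⟨P, hP, hP0⟩ : ∃ P : (W.baseChange L).geomPoints, π P = P ∧ P ≠ 0 := by
      by_contra hno
      push Not at hno
      have : ((1 - π : AddMonoid.End (W.baseChange L).geomPoints) :
          (W.baseChange L).geomPoints →+ (W.baseChange L).geomPoints).ker = ⊥ := by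
        rw [eq_bot_iff]; intro P hPk
        have hPk' : P - π P = 0 := by rw [← h1π]; exact hPk
        exact (AddSubgroup.mem_bot).mpr (hno P (sub_eq_zero.mp hPk').symm)
      rw [this, AddSubgroup.card_bot] at hker'
      exact absurd hker' (by norm_num)
    refine ⟨P, by rw [one_zsmul]; exact hP, hP0, ?_⟩
    have h := cmEndo_apply_apply (W.baseChange L) hrel P
    rw [hP, hP, eq_comm, sub_eq_self] at h
    exact h
  have hmem2 : ∀ {ρ : ℤ_[2]} {c : ℤ}, (2 : ℤ_[2]) ∣ (c : ℤ_[2]) - ρ →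
      ((c : ℤ_[2]) - ρ) ∈ (Ideal.span {(2 : ℤ_[2]) ^ 1} : Ideal ℤ_[2]) := fun h ↦ by
    rw [pow_one]; exact Ideal.mem_span_singleton.mpr h
  have hne : C₁ ≠ ⊥ ∧ C₂ ≠ ⊥ := by
    rcases hdich with h | h
    · refine ⟨hplace r 0 C₁ hC₁ (hmem2 (by rw [Int.cast_zero, zero_sub]; exact (dvd_neg).mpr h)) hkerP,
        hplace (1 - r) 1 C₂ hC₂ (hmem2 (by rw [Int.cast_one, sub_sub_cancel]; exact h)) hker1P⟩
    · refine ⟨hplace r 1 C₁ hC₁ (hmem2 (by rw [Int.cast_one]; exact h)) hker1P,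
        hplace (1 - r) 0 C₂ hC₂ (hmem2 (by
          rw [Int.cast_zero, zero_sub, neg_sub]
          rw [show r - 1 = -(1 - r) by ring]; exact (dvd_neg).mpr h)) hkerP⟩
  exact ⟨C₁, C₂, fun x ↦ (hC₁ x).trans (htr r x), fun x ↦ (hC₂ x).trans (htr (1 - r) x), hinf, hsup, hne.1, hne.2, hGal⟩

/-- **The two eigen-subgroups of `(π, r)` and `(π, 1 − r)` are complementary**: `C ⊓ C' = ⊥`, `C ⊔ C' = E_L[2^∞]` (∀-form).
[cite: SilvermanATAEC1994, II §1 Prop. 1.1 and App. A §3 (row D = -7)] -/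
theorem cmPrimary_compl_two (W : WeierstrassCurve ℚ) [W.IsElliptic] (hj : W.j = -3375)
    (L : Type) [Field L] [NumberField L] {θ : L} (hθ : θ ^ 2 = -7)
    {π : AddMonoid.End (W.baseChange L).geomPoints} (hπ : π ∈ (W.baseChange L).geomEndRing) (hrel : π * π = π - 2)
    {r : ℤ_[2]} (hr : r * r = r - 2) {C C' : AddSubgroup ((W.baseChange L).geomPrimaryTorsion 2)}
    (hC : ∀ x, x ∈ C ↔ ∀ (k : ℕ) (N : ℤ), 2 ^ k • x = 0 →
        ((N : ℤ_[2]) - r) ∈ (Ideal.span {(2 : ℤ_[2]) ^ k} : Ideal ℤ_[2]) →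
          π (x : (W.baseChange L).geomPoints) = N • (x : (W.baseChange L).geomPoints))
    (hC' : ∀ x, x ∈ C' ↔ ∀ (k : ℕ) (N : ℤ), 2 ^ k • x = 0 →
        ((N : ℤ_[2]) - (1 - r)) ∈ (Ideal.span {(2 : ℤ_[2]) ^ k} : Ideal ℤ_[2]) →
          π (x : (W.baseChange L).geomPoints) = N • (x : (W.baseChange L).geomPoints)) :
    C ⊓ C' = ⊥ ∧ C ⊔ C' = ⊤ ∧ C ≠ ⊥ ∧ C' ≠ ⊥ := by
  obtain ⟨C₁, C₂, hC₁, hC₂, hinf, hsup, h₁, h₂, -⟩ := exists_eigen_pair_two W hj L hθ hπ hrel hr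
  have e1 : C = C₁ := by ext x; exact (hC x).trans (hC₁ x).symm
  have e2 : C' = C₂ := by ext x; exact (hC' x).trans (hC₂ x).symm
  subst e1 e2
  exact ⟨hinf, hsup, h₁, h₂⟩

/-- **STRUCTURE OF A CM SUMMAND.** `W/ℚ` elliptic with `j = −3375`, `L` a number field with `θ² = −7`, `π ∈ End_{L̄}(E_L)` with
`π² = π − 2` (then `π` is `L`-rational, companion file …CMEndomorphismSqrtMinusSeven), `r ∈ ℤ₂` ANY root of `X² − X + 2`, and `C ≤ E_L[2^∞]`
the subgroup on which `π` acts as `r` (membership in the integer-approximation currency). Then: `C` is `Γ_L`-stable; `C ≠ 0`; `C` is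
`2`-DIVISIBLE; `#C[2^k] = 2^k` and `C[2^k] = ℤ·g_k` is CYCLIC for every `k` (`C ≅ ℚ₂/ℤ₂`, `ℤ₂`-corank one); and every `σ ∈ Γ_L` acts on
`C[2^k]` as an INTEGER SCALAR `N_k(σ)` (the CM character `ψ_𝔮 : Γ_L → ℤ₂^×` of the summand, level by level). Inputs: `exists_eigen_pair_two`,
`#E[2] = 4` (`card_geomTorsion_two_pow`), `2·E(L̄) = E(L̄)` (`two_nsmul_surjective_of_isAlgClosed`), the generic §1 (…CMComplementStructure).
(Rubin, LNM 1716, §2 and Prop. 5.4: `E[𝔭^∞] ≅ K_𝔭/𝓞_𝔭` with `Γ_K` acting through `ψ_𝔭`.)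
[cite: SilvermanATAEC1994, II §1 Prop. 1.1, II §2 Thm. 2.2(b), App. A §3 (row D = -7)] -/
theorem cmPrimary_structure_two (W : WeierstrassCurve ℚ) [W.IsElliptic] (hj : W.j = -3375)
    (L : Type) [Field L] [NumberField L] {θ : L} (hθ : θ ^ 2 = -7)
    {π : AddMonoid.End (W.baseChange L).geomPoints} (hπ : π ∈ (W.baseChange L).geomEndRing) (hrel : π * π = π - 2)
    {r : ℤ_[2]} (hr : r * r = r - 2) {C : AddSubgroup ((W.baseChange L).geomPrimaryTorsion 2)}
    (hC : ∀ x, x ∈ C ↔ ∀ (k : ℕ) (N : ℤ), 2 ^ k • x = 0 →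
        ((N : ℤ_[2]) - r) ∈ (Ideal.span {(2 : ℤ_[2]) ^ k} : Ideal ℤ_[2]) →
          π (x : (W.baseChange L).geomPoints) = N • (x : (W.baseChange L).geomPoints)) :
    (∀ (σ : absoluteGaloisGroup L), ∀ x ∈ C, σ • x ∈ C) ∧ C ≠ ⊥ ∧
      (∀ x ∈ C, ∃ y ∈ C, 2 • y = x) ∧
      (∀ k : ℕ, Nat.card ↥(C ⊓ AddSubgroup.torsionBy ((W.baseChange L).geomPrimaryTorsion 2) (2 ^ k : ℕ)) = 2 ^ k) ∧
      (∀ k : ℕ, ∃ g ∈ C, addOrderOf g = 2 ^ k ∧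
        C ⊓ AddSubgroup.torsionBy ((W.baseChange L).geomPrimaryTorsion 2) (2 ^ k : ℕ) = AddSubgroup.zmultiples g) ∧
      (∀ (σ : absoluteGaloisGroup L) (k : ℕ), ∃ N : ℤ, ∀ x ∈ C, 2 ^ k • x = 0 → σ • x = N • x) := by
  haveI : Fact (Nat.Prime 2) := ⟨Nat.prime_two⟩
  obtain ⟨C₁, C₂, hC₁, hC₂, hinf, hsup, h₁, h₂, hGal⟩ := exists_eigen_pair_two W hj L hθ hπ hrel hr
  have e1 : C = C₁ := by ext x; exact (hC x).trans (hC₁ x).symm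
  subst e1
  set M := ↥((W.baseChange L).geomPrimaryTorsion 2) with hM_def
  have hMp : ∀ x : M, ∃ k : ℕ, 2 ^ k • x = 0 := fun x ↦ by
    obtain ⟨k, hk⟩ := (AddCommGroup.mem_primaryComponent).mp x.2
    exact ⟨k, Subtype.ext (by rw [AddSubmonoidClass.coe_nsmul, ZeroMemClass.coe_zero]; exact hk)⟩
  -- divisibility of `E(L̄)` by `2` and `#E[2] = 4`
  have h2L : (2 : L) ≠ 0 := two_ne_zero
  have hdiv : ∀ x : M, ∃ y : M, 2 • y = x := fun x ↦ by
    have h2 : (2 : AlgebraicClosure L) ≠ 0 := two_ne_zero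
    haveI : ((W.baseChange L).baseChange (AlgebraicClosure L)).IsElliptic :=
      inferInstanceAs ((W.baseChange L).map (algebraMap L (AlgebraicClosure L))).IsElliptic
    obtain ⟨P, hP⟩ := ((W.baseChange L).baseChange (AlgebraicClosure L)).two_nsmul_surjective_of_isAlgClosed h2
      (x : (W.baseChange L).geomPoints)
    set Q : (W.baseChange L).geomPoints := P with hQ
    have hP' : (2 : ℕ) • Q = (x : (W.baseChange L).geomPoints) := hP
    have hPM : Q ∈ (W.baseChange L).geomPrimaryTorsion 2 := by
      obtain ⟨k, hk⟩ := (AddCommGroup.mem_primaryComponent).mp x.2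
      refine (AddCommGroup.mem_primaryComponent).mpr ⟨k + 1, ?_⟩
      rw [pow_succ, mul_smul, hP', hk]
    exact ⟨⟨Q, hPM⟩, Subtype.ext hP'⟩
  have hcard : Nat.card (AddSubgroup.torsionBy M (2 : ℕ)) = 2 ^ 2 := by
    have hc1 : Nat.card ((W.baseChange L).geomTorsion ((2 ^ 1 : ℕ) : ℤ)) = 2 ^ (2 * 1) :=
      card_geomTorsion_two_pow (W.baseChange L) h2L 1
    rw [pow_one, mul_one] at hc1
    rw [← hc1]
    refine Nat.card_congr
      { toFun := fun x ↦ ⟨((x : M) : (W.baseChange L).geomPoints), by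
          have hx := AddSubgroup.torsionBy.nsmul_iff.mp x.2
          have := congrArg Subtype.val hx
          rw [AddSubmonoidClass.coe_nsmul] at this
          exact AddSubgroup.torsionBy.nsmul_iff.mpr this⟩
        invFun := fun P ↦ ⟨⟨(P : (W.baseChange L).geomPoints), (AddCommGroup.mem_primaryComponent).mpr ⟨1, by
            rw [pow_one]; exact AddSubgroup.torsionBy.nsmul_iff.mp P.2⟩⟩,
            AddSubgroup.torsionBy.nsmul_iff.mpr (Subtype.ext (by
              rw [AddSubmonoidClass.coe_nsmul, ZeroMemClass.coe_zero]
              exact AddSubgroup.torsionBy.nsmul_iff.mp P.2))⟩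
        left_inv := fun x ↦ Subtype.ext (Subtype.ext rfl)
        right_inv := fun P ↦ Subtype.ext rfl }
  refine ⟨fun σ ↦ (hGal σ).1, h₁, fun x hx ↦ exists_nsmul_eq_of_mem hinf hsup hdiv hx,
    card_inf_torsionBy_prime_pow hMp hinf hsup hdiv h₁ h₂ hcard,
    exists_generator_inf_torsionBy hMp hinf hsup hdiv h₁ h₂ hcard, fun σ k ↦ ?_⟩
  obtain ⟨N, hN⟩ := exists_int_smul_eq_on_inf_torsionBy hMp hinf hsup hdiv h₁ h₂ hcard
    (DistribMulAction.toAddMonoidEnd (absoluteGaloisGroup L) M σ) (hGal σ).1 k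
  exact ⟨N, fun x hx hxk ↦ hN x hx hxk⟩

end Curve

end Summit.BirchSwinnertonDyer.BirchSwinnertonDyer.Theorems.PrintCf2.CMPrimes

end
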